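import Summits.AnomalousDissipation.AnomalousDissipation.Theorems.SteadyCoherentFractionRootsPlanarWitnessDefs
import Literature.Analysis.FunctionSpaces.TorusCoordinateFunctions
import Literature.Analysis.FunctionSpaces.TorusCalculusProofs

/-!
# The crossed-shear root of Euler + drift + Kolmogorov force on `T³` — I: profiles, lifts, smoothness, derivatives

Refutation witness for the Liouville cruxes `RootsPlanar` (stmt-AnomalousDissipation-28522) and
`TameEulerClimatesPlanar` (stmt-27427) of the routes `SteadyCoherentFraction` / `CoherentFraction`
(cell decomp-ad; census KILL E31, STATUS 2026-08-30T23:16:46Z, crit-certified on paper l.1223; independently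
lens-4 g22, kernel spec `CrossedShearRoots.lean` a0e7b9766f80b4f9). Objects: `…RootsPlanarWitnessDefs`.
This file: periodicity / positivity / derivatives of the one-variable profiles, the lifts of `v₀, v₁, v, p, f_K` to `ℝ³`
(`Torus.lift`, through `Torus.lift_coordFun_apply`), smoothness, and the Fréchet derivatives of the lifts in applied form.
-/

noncomputable section

-- `Summit.<Summit>.<Problem>` is the tree's mandated summit-side namespace (CONVENTIONS §2); for this
-- single-conjunct summit the two segments coincide, so the duplicate is deliberate.
set_option linter.dupNamespace false

namespace Summit.AnomalousDissipation.AnomalousDissipation.Theorems.CrossedShearRoot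

open Real MeasureTheory
open scoped InnerProductSpace
open Literature.Analysis.FunctionSpaces Literature.Analysis.FunctionSpaces.Torus Literature.Analysis.FluidPDE

/-! ## §1 One-variable profiles -/

/-- `-4π c_K = 1`. [folklore] -/
theorem four_pi_mul_cK : 4 * π * cK = -1 := by
  unfold cK
  field_simp

/-- `c4` is `1`-periodic. [folklore] -/
theorem c4_periodic : Function.Periodic c4 1 := fun t => by
  unfold c4
  rw [show 4 * π * (t + 1) = 4 * π * t + (2 : ℕ) * (2 * π) by push_cast; ring, Real.cos_add_nat_mul_two_pi]

/-- `s4` is `1`-periodic. [folklore] -/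
theorem s4_periodic : Function.Periodic s4 1 := fun t => by
  unfold s4
  rw [show 4 * π * (t + 1) = 4 * π * t + (2 : ℕ) * (2 * π) by push_cast; ring, Real.sin_add_nat_mul_two_pi]

/-- `ρ` is `1`-periodic. [folklore] -/
theorem rho_periodic : Function.Periodic rho 1 := fun t => by
  unfold rho
  rw [show 2 * π * (t + 1) = 2 * π * t + 2 * π by ring, Real.cos_add_two_pi]

/-- `0 < ρ ≤ 3/2` (indeed `ρ ≥ 1/2`). [folklore] -/
theorem rho_profile_pos (t : ℝ) : 0 < rho t ∧ rho t ≤ 3 / 2 := by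
  unfold rho
  constructor
  · linarith [Real.neg_one_le_cos (2 * π * t)]
  · linarith [Real.cos_le_one (2 * π * t)]

/-- `c4' = -4π s4`. [folklore] -/
theorem hasDerivAt_c4 (t : ℝ) : HasDerivAt c4 (-(4 * π) * s4 t) t := by
  have h1 : HasDerivAt (fun t : ℝ => 4 * π * t) (4 * π) t := by
    simpa using (hasDerivAt_id t).const_mul (4 * π)
  have h2 := (Real.hasDerivAt_cos (4 * π * t)).comp t h1
  unfold c4 s4
  exact h2.congr_deriv (by ring)

/-- `s4' = 4π c4`. [folklore] -/
theorem hasDerivAt_s4 (t : ℝ) : HasDerivAt s4 ((4 * π) * c4 t) t := by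
  have h1 : HasDerivAt (fun t : ℝ => 4 * π * t) (4 * π) t := by
    simpa using (hasDerivAt_id t).const_mul (4 * π)
  have h2 := (Real.hasDerivAt_sin (4 * π * t)).comp t h1
  unfold c4 s4
  exact h2.congr_deriv (by ring)

/-- `ρ' = drho`. [folklore] -/
theorem hasDerivAt_rho (t : ℝ) : HasDerivAt rho (drho t) t := by
  have h1 : HasDerivAt (fun t : ℝ => 2 * π * t) (2 * π) t := by
    simpa using (hasDerivAt_id t).const_mul (2 * π)
  have h2 := (((Real.hasDerivAt_cos (2 * π * t)).comp t h1).div_const 2).const_add 1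
  unfold rho drho
  exact h2.congr_deriv (by ring)

/-- The profiles `c4`, `s4`, `ρ` are smooth. [folklore] -/
theorem contDiff_profiles {n : WithTop ℕ∞} : ContDiff ℝ n c4 ∧ ContDiff ℝ n s4 ∧ ContDiff ℝ n rho :=
  ⟨Real.contDiff_cos.comp (contDiff_const.mul contDiff_id), Real.contDiff_sin.comp (contDiff_const.mul contDiff_id),
    contDiff_const.add ((Real.contDiff_cos.comp (contDiff_const.mul contDiff_id)).div_const _)⟩

/-! ## §3 Lifts to `ℝ³` -/

/-- A coordinate function of a `1`-periodic profile evaluated at `proj y`. [folklore] -/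
theorem coordFun_proj {g : ℝ → ℝ} (hg : Function.Periodic g 1) (k : Fin 3) (y : (EuclideanSpace ℝ (Fin 3))) :
    g (repr (proj y) k) = g (y k) := by
  have h := lift_coordFun_apply (F := ℝ) hg k y
  rwa [lift_apply] at h

/-- `lift v₀ (y) = cos(4πy₁)/ρ(y₂)`. [folklore] -/
theorem lift_V0 : lift V0 = fun y : (EuclideanSpace ℝ (Fin 3)) => c4 (y 1) / rho (y 2) := by
  funext y
  rw [lift_apply]
  unfold V0
  rw [coordFun_proj c4_periodic, coordFun_proj rho_periodic]

/-- `lift v₁ (y) = (cos(4πy₀) + c_K) ρ(y₂) - c_K`. [folklore] -/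
theorem lift_V1 : lift V1 = fun y : (EuclideanSpace ℝ (Fin 3)) => (c4 (y 0) + cK) * rho (y 2) - cK := by
  funext y
  rw [lift_apply]
  unfold V1
  rw [coordFun_proj c4_periodic, coordFun_proj rho_periodic]

/-- `lift p (y) = sin(4πy₀) sin(4πy₁)`. [folklore] -/
theorem lift_pres : lift pres = fun y : (EuclideanSpace ℝ (Fin 3)) => s4 (y 0) * s4 (y 1) := by
  funext y
  rw [lift_apply]
  unfold pres
  rw [coordFun_proj s4_periodic, coordFun_proj s4_periodic]

/-- `lift v = (lift v₀) e₀ + (lift v₁) e₁`. [folklore] -/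
theorem lift_vfield : lift vfield = fun y : (EuclideanSpace ℝ (Fin 3)) =>
    (c4 (y 1) / rho (y 2)) • EuclideanSpace.single (0 : Fin 3) (1 : ℝ) +
      ((c4 (y 0) + cK) * rho (y 2) - cK) • EuclideanSpace.single (1 : Fin 3) (1 : ℝ) := by
  funext y
  have h0 := congrFun lift_V0 y
  have h1 := congrFun lift_V1 y
  rw [lift_apply] at h0 h1 ⊢
  unfold vfield
  rw [h0, h1]

/-- `sin(4πy₁)` is the lift of the scalar factor of the force. [folklore] -/
theorem mFourier_020_im (y : (EuclideanSpace ℝ (Fin 3))) :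
    ((UnitAddTorus.mFourier (![0, 2, 0] : Fin 3 → ℤ)) (proj y)).im = s4 (y 1) := by
  simp only [UnitAddTorus.mFourier, ContinuousMap.coe_mk, proj, fourier_coe_apply]
  rw [Fin.prod_univ_three]
  simp only [Matrix.cons_val_zero, Matrix.cons_val_one, Matrix.cons_val_two, Matrix.tail_cons,
    Matrix.head_cons, Int.cast_zero, zero_mul, mul_zero, Complex.exp_zero, one_mul, mul_one,
    Complex.ofReal_one, div_one, Int.cast_ofNat]
  rw [show 2 * ↑π * Complex.I * 2 * ↑(y 1) = ((4 * π * y 1 : ℝ) : ℂ) * Complex.I by push_cast; ring,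
    Complex.exp_ofReal_mul_I_im]
  rfl

/-- `lift f_K (y) = sin(4πy₁) e₀`. [folklore] -/
theorem lift_fK : lift fK = fun y : (EuclideanSpace ℝ (Fin 3)) => s4 (y 1) • EuclideanSpace.single (0 : Fin 3) (1 : ℝ) := by
  funext y
  rw [lift_apply]
  unfold fK
  rw [Literature.Analysis.FluidPDE.Torus.stokesMode_apply]
  simp only [Bool.false_eq_true, ↓reduceIte]
  rw [mFourier_020_im]

/-! ## §4 Smoothness -/

/-- `v₀` is smooth. [folklore] -/
theorem isSmooth_V0 : IsSmooth V0 := by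
  unfold IsSmooth
  rw [lift_V0]
  exact (contDiff_profiles.1.comp (contDiff_piLp_apply (𝕜 := ℝ) (p := 2) (E := fun _ : Fin 3 => ℝ) (i := 1))).div (contDiff_profiles.2.2.comp (contDiff_piLp_apply (𝕜 := ℝ) (p := 2) (E := fun _ : Fin 3 => ℝ) (i := 2)))
    fun y => (rho_profile_pos _).1.ne'

/-- `v₁` is smooth. [folklore] -/
theorem isSmooth_V1 : IsSmooth V1 := by
  unfold IsSmooth
  rw [lift_V1]
  exact (((contDiff_profiles.1.comp (contDiff_piLp_apply (𝕜 := ℝ) (p := 2) (E := fun _ : Fin 3 => ℝ) (i := 0))).add contDiff_const).mul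
    (contDiff_profiles.2.2.comp (contDiff_piLp_apply (𝕜 := ℝ) (p := 2) (E := fun _ : Fin 3 => ℝ) (i := 2)))).sub contDiff_const

/-- `v` is smooth. [folklore] -/
theorem isSmooth_vfield : IsSmooth vfield :=
  (isSmooth_V0.smul' (isSmooth_const _)).add (isSmooth_V1.smul' (isSmooth_const _))

/-- `p` is smooth. [folklore] -/
theorem isSmooth_pres : IsSmooth pres := by
  unfold IsSmooth
  rw [lift_pres]
  exact (contDiff_profiles.2.1.comp (contDiff_piLp_apply (𝕜 := ℝ) (p := 2) (E := fun _ : Fin 3 => ℝ) (i := 0))).mul (contDiff_profiles.2.1.comp (contDiff_piLp_apply (𝕜 := ℝ) (p := 2) (E := fun _ : Fin 3 => ℝ) (i := 1)))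

/-- `f_K` is smooth. [folklore] -/
theorem isSmooth_fK : IsSmooth fK := by
  unfold IsSmooth
  rw [lift_fK]
  exact (contDiff_profiles.2.1.comp (contDiff_piLp_apply (𝕜 := ℝ) (p := 2) (E := fun _ : Fin 3 => ℝ) (i := 1))).smul contDiff_const

/-! ## §5 Derivatives of the lifts -/

/-- The coordinate `y ↦ y i` has derivative `proj i`. [folklore] -/
theorem hasFDerivAt_coord (i : Fin 3) (y : (EuclideanSpace ℝ (Fin 3))) :
    HasFDerivAt (fun y : (EuclideanSpace ℝ (Fin 3)) => y i) (PiLp.proj (𝕜 := ℝ) 2 (fun _ : Fin 3 => ℝ) i) y :=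
  PiLp.hasFDerivAt_apply (𝕜 := ℝ) 2 y i

/-- `∂₀`-component of the derivative of the lift of `v₀` vanishes, `∂₁ = -4π sin(4πy₁)/ρ(y₂)`,
`∂₂ = -cos(4πy₁)ρ'(y₂)/ρ(y₂)²` — in applied form. [folklore] -/
theorem fderiv_lift_V0 (y a : (EuclideanSpace ℝ (Fin 3))) :
    fderiv ℝ (lift V0) y a =
      (-(4 * π) * s4 (y 1) / rho (y 2)) * a 1 + (-(c4 (y 1) * drho (y 2) / rho (y 2) ^ 2)) * a 2 := by
  have hρ : rho (y 2) ≠ 0 := (rho_profile_pos _).1.ne'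
  have h1 := (hasDerivAt_c4 (y 1)).comp_hasFDerivAt y (hasFDerivAt_coord 1 y)
  have h2 := (hasDerivAt_rho (y 2)).comp_hasFDerivAt y (hasFDerivAt_coord 2 y)
  have h3 := (hasDerivAt_inv hρ).comp_hasFDerivAt y h2
  have h := h1.mul h3
  have key := h.congr_of_eventuallyEq (f₁ := lift V0)
    (Filter.Eventually.of_forall fun z => by rw [lift_V0]; simp [div_eq_mul_inv])
  rw [key.fderiv]
  simp only [add_apply, smul_apply, PiLp.proj_apply, smul_eq_mul, Function.comp_apply]
  field_simp
  ring

/-- Derivative of the lift of `v₁`: `∂₀ = -4π sin(4πy₀) ρ(y₂)`, `∂₁ = 0`, `∂₂ = (cos(4πy₀) + c_K)ρ'(y₂)`.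
[folklore] -/
theorem fderiv_lift_V1 (y a : (EuclideanSpace ℝ (Fin 3))) :
    fderiv ℝ (lift V1) y a =
      (-(4 * π) * s4 (y 0) * rho (y 2)) * a 0 + ((c4 (y 0) + cK) * drho (y 2)) * a 2 := by
  have h1 := ((hasDerivAt_c4 (y 0)).comp_hasFDerivAt y (hasFDerivAt_coord 0 y)).add_const cK
  have h2 := (hasDerivAt_rho (y 2)).comp_hasFDerivAt y (hasFDerivAt_coord 2 y)
  have h := (h1.mul h2).sub_const cK
  have key := h.congr_of_eventuallyEq (f₁ := lift V1)
    (Filter.Eventually.of_forall fun z => by rw [lift_V1]; simp)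
  rw [key.fderiv]
  simp only [add_apply, smul_apply, PiLp.proj_apply, smul_eq_mul, Function.comp_apply]
  ring

/-- Derivative of the lift of `p`: `∂₀ = 4π cos(4πy₀) sin(4πy₁)`, `∂₁ = 4π sin(4πy₀) cos(4πy₁)`, `∂₂ = 0`.
[folklore] -/
theorem fderiv_lift_pres (y a : (EuclideanSpace ℝ (Fin 3))) :
    fderiv ℝ (lift pres) y a =
      (4 * π * c4 (y 0) * s4 (y 1)) * a 0 + (4 * π * s4 (y 0) * c4 (y 1)) * a 1 := by
  have h1 := (hasDerivAt_s4 (y 0)).comp_hasFDerivAt y (hasFDerivAt_coord 0 y)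
  have h2 := (hasDerivAt_s4 (y 1)).comp_hasFDerivAt y (hasFDerivAt_coord 1 y)
  have h := h1.mul h2
  have key := h.congr_of_eventuallyEq (f₁ := lift pres)
    (Filter.Eventually.of_forall fun z => by rw [lift_pres]; simp)
  rw [key.fderiv]
  simp only [add_apply, smul_apply, PiLp.proj_apply, smul_eq_mul, Function.comp_apply]
  ring

/-- Derivative of the lift of `v`, applied: `D(lift v)(y) a = (D(lift v₀)(y) a) e₀ + (D(lift v₁)(y) a) e₁`.
[folklore] -/
theorem fderiv_lift_vfield (y a : (EuclideanSpace ℝ (Fin 3))) :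
    fderiv ℝ (lift vfield) y a =
      (fderiv ℝ (lift V0) y a) • EuclideanSpace.single (0 : Fin 3) (1 : ℝ) +
        (fderiv ℝ (lift V1) y a) • EuclideanSpace.single (1 : Fin 3) (1 : ℝ) := by
  have d0 : DifferentiableAt ℝ (lift V0) y := (isSmooth_V0.contDiffAt.differentiableAt (by simp))
  have d1 : DifferentiableAt ℝ (lift V1) y := (isSmooth_V1.contDiffAt.differentiableAt (by simp))
  have h := (d0.hasFDerivAt.smul_const (EuclideanSpace.single (0 : Fin 3) (1 : ℝ))).add
    (d1.hasFDerivAt.smul_const (EuclideanSpace.single (1 : Fin 3) (1 : ℝ)))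
  have key := h.congr_of_eventuallyEq (f₁ := lift vfield)
    (Filter.Eventually.of_forall fun z => by simp only [lift_apply, vfield, Pi.add_apply])
  rw [key.fderiv]
  simp only [add_apply, ContinuousLinearMap.smulRight_apply]


end Summit.AnomalousDissipation.AnomalousDissipation.Theorems.CrossedShearRoot

end
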